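import Summits.BirchSwinnertonDyer.BirchSwinnertonDyer.Theorems.KatoDescentPotSupersingularMemberHullIdeal
import Literature.NumberTheory.EllipticCurves.Kato2004.MemberHullIdealInputs
import HarnessLib

/-!
# Cell `bsd-potss`, crux M `ReducibleKatoMember` (item stmt-BirchSwinnertonDyer-19196): the IDEAL-HULL currency
# of the held input is a THEOREM of the value-guarded fact — ROUTE-FREE kernel module:
# `exists_memberHullValueInputs → GZK → (the same ∀∃ shell with Nonempty (MemberHullIdealInputs …))`

Seat `bsd-potss-rkm` generation 10.  `Kato2004.MemberHullIdealInputs` (file `Kato2004/MemberHullIdealInputs.lean`,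
this seat; NO named fact there, by review) is `MemberHullValueInputs` with the abstract hull `(F, j, z ∈ F)`
replaced by `(j : 𝐇¹_Γ →ₗ[Λ] Λ` injective of finite index, `z ∈ Λ)`.  This module proves, as theorems:
* `nonempty_memberHullIdealInputs_of_value` — one pin: a value package over the lift of a guarded `ZetaBody`
  witness (`W(ℚ)`, `Ш(W)[p^∞]` finite) yields an ideal-hull package, by
  `MemberHullIdeal.MemberHullValueInputs.exists_ideal_hull_of_zetaBody` (p531032: rank one from the value,
  cn100's rank-one reflexive hull, index calculus, monotone lengths) and `MemberHullIdealInputs.ofValueInputs`;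
* `nonempty_memberHullValueInputs_of_ideal` — conversely (`F := Λ`), no hypothesis;
* **`forall_nonempty_memberHullIdealInputs_of_valueInputs`** — the full `∀∃` shell of
  `exists_memberHullValueInputs` (same hypotheses, same member, same witnesses and guard, same pin) with the
  conclusion `Nonempty (MemberHullIdealInputs W_K p κ γ I 𝐲)`, from `exists_memberHullValueInputs` and GZK
  (`rank_eq_analyticRank_of_analyticRank_le_one`: analytic rank `0` ⇒ `W_K(ℚ)` finite; `Ш(W_K)` finite along the
  isogeny) — i.e. what a `def exists_memberHullIdealInputs : Prop` would say, as a THEOREM of the held fact.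
CONDITIONAL on the named facts (audit `proof.conditional`); no item is closed here.  HONEST FRAMING: BSD is not
advanced; nothing is booked.

References: [Kato2004Asterisque] Thm. 12.4 (2) (p. 221), Thm. 12.5 (3) (p. 222), 13.14 (p. 234), Thm. 14.5
(p. 236), §14.14 (p. 243); [BourbakiAC5to7] VII §4 no. 2; [Wuthrich2014] Lemma 12; [Darmon2004] Thm. 3.22.
-/

set_option autoImplicit false
set_option linter.dupNamespace false

noncomputable section

open scoped NumberField TensorProduct
open Field IsDedekindDomain CongruenceSubgroup Function
open Literature.NumberTheory.GaloisRepresentations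
open Literature.NumberTheory.EllipticCurves Literature.NumberTheory.EllipticCurves.ModularForms
open Literature.NumberTheory.EllipticCurves.Kato2004
open Literature.NumberTheory.EllipticCurves.Kato2004.EulerSystemValues Rat.HeightOneSpectrum
open Literature.NumberTheory.EllipticCurves.IwasawaAlgebra

namespace Summit.BirchSwinnertonDyer.BirchSwinnertonDyer.Theorems.ReducibleOfIdealInputs

section Pin

variable {W : WeierstrassCurve ℚ} [W.IsElliptic] {p : ℕ} [Fact p.Prime]
  [ContinuousSMul ℤ_[p] (W.tateModule p)] [Module.Free ℤ_[p] (W.tateModule p)]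
  [Module.Finite ℤ_[p] (W.tateModule p)] {N : ℕ} [NeZero N] {f : CuspForm (Gamma0 N) 2}
  {ι : (m : ℕ) → (CyclotomicField m ℚ →+* ℂ)} {κ' : ℝ}
  {Λ : ∀ (k : ℕ) (r : Finset (HeightOneSpectrum (𝓞 ℚ))),
    H1 (tateRep W p) (cycSubgroup p k r) →ₗ[ℤ_[p]] ℚ_[p] ⊗[ℚ] CyclotomicField (cycLevel p k r) ℚ}
  {c d a : ℤ} {A : ℕ}
  {z : ∀ (k : ℕ) (r : (cyclotomicLevelsRat p (badPlaces c d A N)).Ideals),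
    H1 (tateRep W p) ((cyclotomicLevelsRat p (badPlaces c d A N)).level k r.1)}
  {x : ∀ (k : ℕ) (r : (cyclotomicLevelsRat p (badPlaces c d A N)).Ideals),
    CyclotomicField (cycLevel p k r.1) ℚ}
  {V : WeierstrassCurve ℚ} [V.IsElliptic]
  {κ : ZpExtension ℚ p} {γ : absoluteGaloisGroup ℚ} {I : IwasawaH1Data W p κ γ} {y : I.H}

/-- **One pin: a value package over the lift of a guarded `ZetaBody` witness yields an ideal-hull package**
(`W(ℚ)`, `Ш(W)[p^∞]` finite): `MemberHullIdeal.MemberHullValueInputs.exists_ideal_hull_of_zetaBody` +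
`MemberHullIdealInputs.ofValueInputs`. [cite: Kato2004Asterisque, 13.14 (p. 234), Thm. 12.5 (3) (p. 222)] -/
theorem nonempty_memberHullIdealInputs_of_value (P : MemberHullValueInputs W p κ γ I y)
    [Finite W.toAffine.Point] [Finite (AddCommGroup.primaryComponent W.sha p)]
    (hκ : κ.IsCyclotomic) (hγ : κ.IsTopGenerator γ) (hp : p ≠ 2)
    (hbody : ZetaBody W p f ι κ' Λ c d a A z x) (hκ' : κ' ≠ 0)
    (hf : IsNewformOf V f) (hL1 : V.entireLFunction 1 ≠ 0) (hA : 0 < A) (d' : ℤ)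
    (hcd : Int.gcd (c * d) A = 1) (hdd' : d * d' ≡ 1 [ZMOD (A : ℤ)])
    (hR : cuspFactor f true (fun _ ↦ 1) c d a A d' ≠ 0)
    (hy : ∀ n : ℕ, I.proj n y = levelToLayer W p hκ hp (badPlaces c d A N) n
      (z (n + 1) (cyclotomicLevelsRat p (badPlaces c d A N)).idealOne)) :
    Nonempty (MemberHullIdealInputs W p κ γ I y) := by
  obtain ⟨j', z', hj', hfin, hjy, hdiv⟩ :=
    MemberHullIdeal.MemberHullValueInputs.exists_ideal_hull_of_zetaBody P hκ hγ hp hbody hκ' hf hL1 hA d' hcd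
      hdd' hR hy
  exact ⟨MemberHullIdealInputs.ofValueInputs P j' hj' hfin z' hjy hdiv⟩

omit [Module.Free ℤ_[p] (W.tateModule p)] [Module.Finite ℤ_[p] (W.tateModule p)] in
/-- **Conversely, an ideal-hull package is a value package** (`F := Λ`), on any pin.
[cite: Kato2004Asterisque, 13.14 (p. 234)] -/
theorem nonempty_memberHullValueInputs_of_ideal (Q : MemberHullIdealInputs W p κ γ I y) :
    Nonempty (MemberHullValueInputs W p κ γ I y) :=
  ⟨Q.toMemberHullValueInputs⟩

end Pin

/-- **The `∀∃` shell of the held fact in IDEAL-HULL currency, as a THEOREM of the held fact and GZK.**  From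
`exists_memberHullValueInputs` and `rank_eq_analyticRank_of_analyticRank_le_one`: for every globally minimal
`W/ℚ`, `p ≠ 2` additive potentially good, `W[p]` reducible, `L(W,1) ≠ 0`, `Ш(W)` finite, there is a globally
minimal member `W_K ∼ W` such that for the newform `f` of `W` and all embeddings `ι` there are witnesses
`(κ', Λ', c, d, a, A, z, x)` with the guards of the value fact (incl. `(cd, A) = 1`, `∃ d′, dd′ ≡ 1 (A) ∧
R⁻ ≠ 0`) and `ZetaBody W_K p f ι κ' Λ' c d a A z x`, and on every cyclotomic pin `I` with THE lift `𝐲`,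
`Nonempty (MemberHullIdealInputs W_K p κ γ I 𝐲)` — the hull INSIDE `Λ`, `z_γ⁰, λ ∈ Λ`.  (What a named fact
`exists_memberHullIdealInputs` would assert; here a theorem.)  `W_K(ℚ)` finite by analytic rank `0` + GZK +
`mordellWeilRank_eq_zero_iff_finite` + `finite_point_of_isIsogenous`; `Ш(W_K)` finite by
`IsIsogenous.shaFinite_iff_shaFinite`.
[cite: Kato2004Asterisque, Thm. 12.4 (2) (p. 221), Thm. 12.5 (3) (p. 222), 13.14 (p. 234), Thm. 14.5 (1)(2) (p. 236)]
[cite: Darmon2004, Thm. 3.22] [cite: BourbakiAC5to7, Ch. VII §4 no. 2] -/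
theorem forall_nonempty_memberHullIdealInputs_of_valueInputs (hV : Kato2004.exists_memberHullValueInputs)
    (hGZK : rank_eq_analyticRank_of_analyticRank_le_one) :
    ∀ (W : WeierstrassCurve ℚ) [W.IsElliptic] [W.IsGloballyMinimal] (p : ℕ) [Fact p.Prime]
      (hp : p ≠ 2),
      ¬ W.HasGoodReductionAtPrime p → ¬ W.HasMultiplicativeReductionAtPrime p →
      0 ≤ padicValRat p W.j →
      ¬ W.HasIrreducibleModPGaloisRep p →
      W.entireLFunction 1 ≠ 0 → Finite W.sha →
      ∃ (W' : WeierstrassCurve ℚ) (_ : W'.IsElliptic) (_ : W'.IsGloballyMinimal),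
        WeierstrassCurve.IsIsogenous W W' ∧
        ∀ [ContinuousSMul ℤ_[p] (W'.tateModule p)] [Module.Free ℤ_[p] (W'.tateModule p)]
          [Module.Finite ℤ_[p] (W'.tateModule p)],
        ∀ {N : ℕ} [NeZero N] (f : CuspForm (Gamma0 N) 2), IsNewformOf W f →
        ∀ (ι : (m : ℕ) → (CyclotomicField m ℚ →+* ℂ)),
        ∃ (κ' : ℝ) (Λ' : ∀ (k : ℕ) (r : Finset (HeightOneSpectrum (𝓞 ℚ))),
            H1 (tateRep W' p) (cycSubgroup p k r) →ₗ[ℤ_[p]] ℚ_[p] ⊗[ℚ] CyclotomicField (cycLevel p k r) ℚ)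
          (c d a : ℤ) (A : ℕ)
          (z : ∀ (k : ℕ) (r : (cyclotomicLevelsRat p (badPlaces c d A N)).Ideals),
            H1 (tateRep W' p) ((cyclotomicLevelsRat p (badPlaces c d A N)).level k r.1))
          (x : ∀ (k : ℕ) (r : (cyclotomicLevelsRat p (badPlaces c d A N)).Ideals),
            CyclotomicField (cycLevel p k r.1) ℚ),
          κ' ≠ 0 ∧ 0 < A ∧ Int.gcd c (6 * p * A) = 1 ∧ Int.gcd d (6 * p * N) = 1 ∧
          Int.gcd (c * d) A = 1 ∧
          (∃ d' : ℤ, d * d' ≡ 1 [ZMOD (A : ℤ)] ∧ cuspFactor f true (fun _ ↦ 1) c d a A d' ≠ 0) ∧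
          ZetaBody W' p f ι κ' Λ' c d a A z x ∧
          ∀ (κ : ZpExtension ℚ p) (γ : absoluteGaloisGroup ℚ) (hκ : κ.IsCyclotomic),
            κ.IsTopGenerator γ →
            ∀ (I : IwasawaH1Data W' p κ γ) (y : I.H),
              (∀ n : ℕ, I.proj n y = levelToLayer W' p hκ hp (badPlaces c d A N) n
                (z (n + 1) (cyclotomicLevelsRat p (badPlaces c d A N)).idealOne)) →
              Nonempty (MemberHullIdealInputs W' p κ γ I y) := by
  intro W _ _ p _ hp hgood hmult hj hirr hL hsha
  obtain ⟨W', hW'e, hW'm, hiso, hrest⟩ := hV W p hp hgood hmult hj hirr hL hsha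
  haveI := hW'e
  have h0 : W.analyticRank = 0 :=
    Summit.BirchSwinnertonDyer.Rank1Residual.O5.analyticRank_eq_zero_of_entireLFunction_one_ne_zero W hL
  obtain ⟨hrk, -⟩ := hGZK W (by rw [h0]; exact zero_le_one)
  rw [h0] at hrk
  haveI hWfin : Finite W.toAffine.Point := (W.mordellWeilRank_eq_zero_iff_finite).mp hrk
  haveI hW'fin : Finite W'.toAffine.Point := finite_point_of_isIsogenous hiso.symm_of_isElliptic hWfin
  have hshaW' : W'.ShaFinite := hiso.shaFinite_iff_shaFinite.mp hsha
  haveI : Finite W'.sha := hshaW'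
  refine ⟨W', hW'e, hW'm, hiso, ?_⟩
  intro _ _ _ N _ f hf ι
  obtain ⟨κ', Λ', c, d, a, A, z, x, hκ', hA, hc, hd, hcd, ⟨d', hdd', hR⟩, hZB, hall⟩ := hrest f hf ι
  refine ⟨κ', Λ', c, d, a, A, z, x, hκ', hA, hc, hd, hcd, ⟨d', hdd', hR⟩, hZB, ?_⟩
  intro κ γ hκ hγ I y hy
  obtain ⟨P⟩ := hall κ γ hκ hγ I y hy
  exact nonempty_memberHullIdealInputs_of_value P hκ hγ hp hZB hκ' hf hL hA d' hcd hdd' hR hy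

end Summit.BirchSwinnertonDyer.BirchSwinnertonDyer.Theorems.ReducibleOfIdealInputs

end
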